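import Summits.CriticalPhenomena.CardyFormulaZ2.Theorems.CardySusyWardWeakHolomorphyStaggeredFourDartFree
import Summits.CriticalPhenomena.CardyFormulaZ2.Theorems.CardySusyWardWeakHolomorphyStaggeredArrivalGlue
import Summits.CriticalPhenomena.CardyFormulaZ2.Theorems.CardySusyWardWeakHolomorphyStaggeredArrivalOfOnceLeft

/-!
# Skeleton v13 (lead c5, 2026-08-17) of the line `Sketch` for the crux `CardySusyWard.WeakHolomorphy`
# (stmt-CriticalPhenomena-11292)

Lead prover `prover-line-stmt-CriticalPhenomena-11292-c5-0` (after leads `-0`, `-1`, `c1`–`c4`).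

v9 (lead c3, `Cruxes/WeakHolomorphy/Lines/Sketch.lean`) had ONE stub, `stub_aliasWeaklyVanishes`, kernel-equivalent to
the crux (`weakHolomorphy_iff_alias`, p147516).  v10/v11 re-cut the crux along its weak-Kirchhoff normal form
(`weakHolomorphy_iff_weakKirchhoff`, p146996: the crux ⟺ `δ^{5/3} Σ_p ∂φ(z_p)·K^s_p → 0`,
`K^s_p = F(NE)+F(SW)−F(NW)−F(SE) = s_p·(in_p − out_p)`, `s_p = ±1` the horizontal/vertical sublattice sign) using the
identity `K^s_p = 2·s_p·in_p − s_p·(in_p + out_p)`: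

* `stub_staggeredFourDartFree` — the sublattice-STAGGERED four-dart sum `s_p·Σ_k F(c_{p,k}) = s_p (in_p + out_p)` of the
  spin-`1/3` dart observable pairs to `o(δ^{-5/3})` with EVERY smooth compactly supported weight, along every eventually
  admissible mesh family (no Dobrushin-domain convergence needed).  This is the dart form of `Cruxes/WeakHolomorphy/Disproof.lean`
  §C (`StaggeredBisectorPairingVanishes`, sorried there; the bisector vertex observable is `(in + out)/(2 cos 15°)` by the
  four-dart split `fourDart_split_medialExploration_spin`).  Proof route (two lines over landed files): by the alias corner
  identity `alias_corner_eq` (p147792) `Σ_k F^{(1/3)}(c_{p,k}) = −(−1)^{c₀.2}·K^{s,(−5/3)}_p`, the signed Kirchhoff combination of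
  the spin-`−5/3` dart observable, and `s_p K^{s,(−5/3)}_p = (in − out)^{(−5/3)}_p` is an unstaggered DIVERGENCE, which telescopes
  against smooth weights exactly as in `smoothDivergence_tendsto_zero` (p146997, verbatim at spin `−5/3`): `O(δ^{2/3})`.
* `stub_weakKirchhoffOfStaggeredArrival` — glue, per family and test function (bookkeeping): the free mode and the
  staggered ARRIVAL law below imply the weak Kirchhoff law, hence the crux by `weakHolomorphy_iff_weakKirchhoff` (`K^s = 2 s·in − s·(in+out)`, finsum linearity above the finite vertex set of
  `stub_count`, `∂φ` is a smooth compactly supported weight).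
* `stub_staggeredArrivalVanishes` — THE OPEN STUB (crux-equivalent given the other two and the converse bookkeeping): along
  every admissible family and for every test function, `δ^{5/3} Σ_p ∂φ(z_p)·s_p·in_p → 0`, where `in_p = F(c_{p,1}) + F(c_{p,3})`
  at a horizontal and `F(c_{p,0}) + F(c_{p,2})` at a vertical medial vertex is the sum of the two ARRIVING dart observables
  (all arrivals of the exploration at `z_p`, first and second, with their entry phases `e^{-iW/3}`).  Equivalently with
  departures.  This halves the unknowns of the v9/weak-Kirchhoff normal form (in-darts only) and is the statement
  "the `∂φ`-tested, h/v-staggered ARRIVAL phase observable of the percolation exploration is `o(δ^{1/3})` per vertex, weakly".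

v11: stubs 1 and 2 are LANDED (`stub_staggeredFourDartFree`, p155223, file `…StaggeredFourDartFree.lean`;
`stub_weakKirchhoffOfStaggeredArrival`, p155735, file `…StaggeredArrivalGlue.lean`, with the per-family converse
`staggeredArrival_tendsto_iff_weakKirchhoff`) and imported; ONE stub remains, `stub_staggeredArrivalVanishes`, which by
`weakHolomorphy_iff_staggeredArrival` (this seat) is EQUIVALENT to the crux.  `WeakHolomorphy_of` composes BY STATEMENT through
`weakHolomorphy_iff_weakKirchhoff` (no new definitions).

v12 cut once more, inside the arrival form, along the landed node template (`inTemplateIdentity`, p146994: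
`in_p = (2+λ²) Z_L(p) + (2+λ̄²) Z_R(p)` at interior vertices of hole-free admissible data, `λ = e^{-iπ/6}`,
`Z_t = onceChiralObs (Λ δ) δ (1/3) z_p t` the once-visit chiral sums) and the Kirchhoff identity (`kirchhoffIdentity`, p114738:
`in − out = κ_L Z_L + κ_R Z_R`): with the free mode these give, per family and test function, staggered arrival law ⟺
staggered once-LEFT law (`stub_staggeredArrivalOfOnceLeft`, bookkeeping + the non-vanishing of two explicit constants), and the
ONE open stub becomes `stub_staggeredOnceLeftVanishes`: `δ^{5/3} Σ_p ∂φ(z_p)·s_p·Z_L(p) → 0` — one chirality class, no left/right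
comparison, no `e^{iπ/6}` datum (crux-equivalent again, by the converse bookkeeping riding with the stub).

v13 (this file): `stub_staggeredArrivalOfOnceLeft` is LANDED (p158303, file `…StaggeredArrivalOfOnceLeft.lean`, with the converse
`staggeredOnceLeft_of_staggeredArrival` and the per-family iff `staggeredOnceLeft_tendsto_iff_staggeredArrival`) and imported;
the ONE open stub is `stub_staggeredOnceLeftVanishes`, EQUIVALENT to the crux (`weakHolomorphy_iff_staggeredOnceLeft`, this seat,
`Theorems/CardySusyWardWeakHolomorphyStaggeredArrivalCrux.lean`).  Stubs closed this seat: stub_staggeredFourDartFree (p155223),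
stub_weakKirchhoffOfStaggeredArrival (p155735), stub_staggeredArrivalOfOnceLeft (p158303); open: stub_staggeredOnceLeftVanishes (≡ crux).  References: Duminil-Copin–Smirnov arXiv:1109.1549
§8.3 (Conj. 8.7); Duminil-Copin arXiv:1208.3787 Prop. 4; crux workfiles `Cruxes/WeakHolomorphy/{Disproof.lean §C–§D,
STRATEGY-CENSUS.md §1, Lines/Sketch.md}`.
-/

noncomputable section

namespace Summit.CriticalPhenomena.CardyFormulaZ2.Theorems.WeakHolomorphy.SplitBypass

open scoped BigOperators Topology
open Filter Set MeasureTheory Complex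
open _root_.Literature.Probability.LatticeModels
open _root_.Literature.Probability.RandomPlanarGeometry (DobrushinDomain)
open _root_.Literature.Probability.Percolation (BondConfig bondPercolation half)
open _root_.Literature.Barriers.CriticalPhenomena (medialCornersAt medialVertexOf)
open Summit.CriticalPhenomena.CardyFormulaZ2.Theorems.ParafermionPrecompact.Negative (IsFamily)

/-- **`stub_staggeredOnceLeftVanishes` — the staggered once-LEFT law (OPEN; crux-equivalent).** Along every admissible
square-lattice discretisation family `Λ` of every Dobrushin domain `D` and for every smooth test function `φ` compactly supported
in the domain, `δ^{5/3} · Σ_p ∂φ(z_p) · s_p · Z_L(p) → 0` as `δ → 0⁺`, where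
`Z_L(p) = onceChiralObs (Λ δ) δ (1/3) (medialVertexOf p) true = E[1{z_p visited exactly once, turning left}·e^{-iW_arrival/3}]` is the
once-visit LEFT chiral sum of the exploration at the medial vertex `z_p`, `s_p = ±1` the sublattice sign and `∂φ = (∂_xφ − i∂_yφ)/2`.
One chirality class; no left/right comparison and no `e^{iπ/6}` datum appear. [cite: DuminilCopinSmirnov2012Lattice, Conjecture 8.7] -/
theorem stub_staggeredOnceLeftVanishes : ∀ (D : DobrushinDomain) (Λ : ℝ → DiscreteDobrushin), IsFamily D Λ →
    ∀ (φ : ℂ → ℂ), ContDiff ℝ (⊤ : ℕ∞) φ → HasCompactSupport φ → tsupport φ ⊆ D.carrier →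
      Tendsto (fun δ : ℝ => ((δ ^ ((5:ℝ) / 3) : ℝ) : ℂ) * ∑ᶠ p : Site 2 × Fin 2,
          (fderiv ℝ φ (medialPoint δ (medialVertexOf p)) 1 -
              Complex.I * fderiv ℝ φ (medialPoint δ (medialVertexOf p)) Complex.I) / 2 *
            ((if p.2 = 0 then (1 : ℂ) else -1) * onceChiralObs (Λ δ) δ (1 / 3) (medialVertexOf p) true))
        (𝓝[>] 0) (𝓝 0) := by
  sorry

/-- **The line closes the crux modulo its stubs** (the crux BY NAME), through `weakHolomorphy_iff_weakKirchhoff`. [folklore] -/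
theorem WeakHolomorphy_of : Summit.CriticalPhenomena.CardyFormulaZ2.Theses.CardySusyWard.WeakHolomorphy :=
  weakHolomorphy_iff_weakKirchhoff.2 fun D Λ hΛ φ hφ hc hs =>
    stub_weakKirchhoffOfStaggeredArrival D Λ hΛ φ hφ hc hs (stub_staggeredFourDartFree Λ hΛ.2.2.2.2.2)
      (stub_staggeredArrivalOfOnceLeft D Λ hΛ φ hφ hc hs (stub_staggeredFourDartFree Λ hΛ.2.2.2.2.2)
        (stub_staggeredOnceLeftVanishes D Λ hΛ φ hφ hc hs))

end Summit.CriticalPhenomena.CardyFormulaZ2.Theorems.WeakHolomorphy.SplitBypass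

end
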